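import Summits.BirchSwinnertonDyer.BirchSwinnertonDyer.Theorems.CumulativeHeegnerLeopoldtCumulativeHeegnerInclusionAtThreeLayerControlDual
import Summits.BirchSwinnertonDyer.BirchSwinnertonDyer.Theorems.CumulativeHeegnerLeopoldtCumulativeHeegnerInclusionAtThreeLayerControlCell
import Summits.BirchSwinnertonDyer.BirchSwinnertonDyer.Theorems.CumulativeHeegnerLeopoldtCumulativeHeegnerInclusionAtThreeLayerTower
import Literature.RingTheory.FittingIdeal.QuotientRing
import Summits.BirchSwinnertonDyer.BirchSwinnertonDyer.Theorems.CumulativeHeegnerLeopoldtCumulativeHeegnerInclusionAtThreeLayerTowerControl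
import HarnessLib

/-!
# Crux K1 `CumulativeHeegnerInclusionAtThree` (stmt-BirchSwinnertonDyer-24198) / crux A (stmt-26896): the
# MAZUR–TATE DOOR ON THE GENUINE LAYER SELMER GROUPS — a Fitting membership for
# `Hom(Sel_{𝔭′}^Σ(K_m, E[3^∞]), ℚ/ℤ)` at every layer `m` gives A (and K1), BY NAME

Width seat bsd-line-chl-k1-p1-w7 g0 (`--supports stmt-BirchSwinnertonDyer-24198`), capstone of lane [P-ctl] (c). THEOREMS ONLY
(no definition, no named fact, no `sorry`). Composition — nothing new is constructed — of
* -w8 g0's layer control on the Leopoldt cell (`…LayerControlCell.cell_layerControl_of_bad_subset`: for `Σ ⊇ {bad v ∤ 3}`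
  EXACT control `Sel_{𝔭′}^Σ(K_m, E[3^∞]) ≅ Sel_{𝔭′}^Σ(K_∞, E[3^∞])^{Γ_m}` at EVERY layer `m`, no residual input) and its
  dual form (`…LayerControlDual.fittingIdeal_layer_le_sup_of_control`: `Fitt₀^Λ(Hom(Sel_{𝔭′}^Σ(K_m), ℚ/ℤ)) ⊆ Fitt₀^Λ(X^Σ) + (ω_m)`,
  with the `Σ`-passage `fittingIdeal_XAc_le_empty`: `Fitt₀(X^Σ) ⊆ Fitt₀(X^∅)`),
* -w2 g5's layer-tower door (`…LayerTower.temperedHeegnerInclusionAtThree_of_fittingLayerTower`: (LT) ⟹ A),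
* this seat's `Literature/RingTheory/FittingIdeal/QuotientRing.lean` (Fitting ideals over `Λ ⧸ (ω_m)` = images of those over `Λ`),
into ONE by-name door whose hypothesis speaks only of the FINITE-LAYER Selmer groups:

  (MT-Sel)  at every frame of A: `∃ Σ ⊇ {bad v ∤ 3}` finite, `∃ μ ∃ (θ_m) ∀ m`:
            `θ_m ∈ Fitt₀^Λ( Hom(Sel_{𝔭′}^Σ(K_m, E[3^∞]), ℚ/ℤ) ) + (ω_m)`  and  `3^μ · L ∈ (θ_m) + (3^m) + (ω_m)` in `R₀⟦T⟧`,

the layer Selmer dual being the tree's `LocNilDual (Sel_{𝔭′}^Σ(K_m)) f h` for ANY endomorphism `f` agreeing with `conj_γ`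
(`Λ`-structure `1 + T ↦ conj_γ`; `ω_m = (1+T)^{3^m} − 1` kills it since `conj_γ^{3^m} = id` on `H¹(K_m, ·)`). The Fitting clause
is stated modulo `(ω_m)`, so BOTH currencies feed it: `Fitt₀^Λ` directly, and the Mazur–Tate / Kurihara currency
`θ̄_m ∈ Fitt₀^{Λ/(ω_m)}(Hom(Sel(K_m), ℚ/ℤ))` over the layer ring `Λ ⧸ (ω_m) = ℤ₃[Gal(K_m/K)]` through
`mk_mem_fittingIdeal_layerDual_iff` (§1, `Module.mk_mem_fittingIdeal_quotientRing_iff`).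

* §1 `isDualPair_locNilDual`, `pow_eq_one_of_coe_eq` (`f^{pⁿ} = 1`), `omega_smul_layerDual_eq_zero`,
  `isTorsionBySet_layerDual` (`(ω_n)` kills the layer dual ⟹ it is a `Λ ⧸ (ω_n)`-module), `mk_mem_fittingIdeal_layerDual_iff`;
* §2 `pow_mul_mem_map_fittingIdeal_empty_sup_layer_of_selmerDual` — generic `K`, `p`, `κ`, `Σ`: control at layer `n` +
  the (MT-Sel) clauses at layer `n` ⟹ the layer-`n` clause of (LT) for `X^∅`;
* §3 BY NAME: **`temperedHeegnerInclusionAtThree_of_mazurTateTower_selmerDual`** ((MT-Sel) ⟹ A),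
  **`cumulativeHeegnerInclusionAtThree_of_print_of_mazurTateTower_selmerDual`** (P ∧ (MT-Sel) ⟹ K1),
  **`cumulativeHeegnerInclusionAtThree_of_integralMazurTateTower_selmerDual`** (integral (MT-Sel) ⟹ K1, print-free).

(MT-Sel) is DISPLAYED, not constructed: its construction is the research content [R-layer-KS] + [R-layer-rec] of the K1
lead's census. K1, A and every summit statement stay OPEN; BSD is not proved by any of this.
References: [MazurTate1987] §1; [KimKurihara2021] §1; [BertoliniDarmon1990] §2; [GreenbergLNM1716] §3; [StacksProject] Tag 07ZA.
-/

set_option linter.dupNamespace false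
set_option autoImplicit false

noncomputable section

open scoped Classical

namespace Summit.BirchSwinnertonDyer.BirchSwinnertonDyer.Theorems.CumulativeHeegnerInclusionAtThreeLayerSelmerDualDoor

open NumberField IsDedekindDomain Field
open Literature.NumberTheory.EllipticCurves Literature.NumberTheory.EllipticCurves.GreenbergSelmer
open Literature.NumberTheory.EllipticCurves.IwasawaDual
open Literature.NumberTheory.GaloisRepresentations
open Summit.BirchSwinnertonDyer.Rank1Residual.X11b Summit.BirchSwinnertonDyer.Rank1Residual.X11b.AcSelmer
open Summit.BirchSwinnertonDyer.BirchSwinnertonDyer.Theorems.CumulativeHeegnerInclusionAtThreeLayerControl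
open Summit.BirchSwinnertonDyer.BirchSwinnertonDyer.Theorems.CumulativeHeegnerInclusionAtThreeLayerControlDual
open Summit.BirchSwinnertonDyer.BirchSwinnertonDyer.Theorems.CumulativeHeegnerInclusionAtThreeLayerControlCell
open Summit.BirchSwinnertonDyer.BirchSwinnertonDyer.Theorems.CumulativeHeegnerInclusionAtThreeLayerTower
open Summit.BirchSwinnertonDyer.BirchSwinnertonDyer.Theorems.BiquadraticEisensteinDescentDefs
open Literature.RingTheory.FittingIdeal
open Summit.BirchSwinnertonDyer.BirchSwinnertonDyer.Theorems.CumulativeHeegnerInclusionAtThreeLayerTowerControl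

/-! ## §1 The layer Selmer dual is killed by `ω_n`; its Fitting ideals over `Λ ⧸ (ω_n)` -/

section Generic

variable {p : ℕ} [Fact p.Prime] {T : Type*} [AddCommGroup T] {f : AddMonoid.End T} (h : IsLocNil p (f - 1))

/-- `(LocNilDual T f h, T)` is a Pontryagin dual pair in the sense of `IwasawaDual.IsDualPair` for `ψ = f − 1`,
`toDual = id` (the type IS `Hom(T, ℚ/ℤ)` with the canonical `Λ`-action). [cite: GreenbergLNM1716, §1 p. 60 (after Conj. 1.3)] -/
theorem isDualPair_locNilDual : IsDualPair p (f - 1) (AddMonoidHom.id (LocNilDual T f h)) where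
  bijective := Function.bijective_id
  T_smul x s := by
    show ((PowerSeries.X : IwasawaAlgebra p) • x) s = x ((f - 1) s)
    rw [LocNilDual.X_smul_apply, End_sub_apply, AddMonoid.End.one_apply, map_sub]
  C_smul c x s k hk := by
    show ((PowerSeries.C c : IwasawaAlgebra p) • x) s = (PadicInt.toZModPow k c).val • x s
    exact LocNilDual.C_smul_apply h c x hk
  locNil := h

/-- **If `f^{pⁿ} = 1` then `ω_n = (1+T)^{pⁿ} − 1` kills `LocNilDual T f h`** (`ω_n` acts as precomposition by
`f^{pⁿ} − 1`, `IsDualPair.toDual_omega_smul`). [cite: GreenbergLNM1716, §1 p. 62 (`θ_n`)] [cite: Washington1997, §13.2] -/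
theorem omega_smul_eq_zero_of_pow_eq_one (n : ℕ) (hf : f ^ p ^ n = 1) (x : LocNilDual T f h) :
    (((1 + PowerSeries.X : IwasawaAlgebra p) ^ (p ^ n) - 1)) • x = 0 := by
  refine LocNilDual.ext h fun s ↦ ?_
  have e : ((((1 + PowerSeries.X : IwasawaAlgebra p) ^ (p ^ n) - 1)) • x) s = x ((f ^ (p ^ n) - 1) s) :=
    (isDualPair_locNilDual h).toDual_omega_smul n x s
  rw [e, hf, sub_self]
  show x ((0 : T →+ T) s) = (0 : T →+ AddCircle (1 : ℚ)) s
  rw [AddMonoidHom.zero_apply, map_zero, AddMonoidHom.zero_apply]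

/-- **`LocNilDual T f h` is `(ω_n)`-torsion when `f^{pⁿ} = 1`** — hence a module over the layer ring
`Λ ⧸ (ω_n)` (`Module.IsTorsionBySet.module`). [cite: Washington1997, §13.2] -/
theorem isTorsionBySet_of_pow_eq_one (n : ℕ) (hf : f ^ p ^ n = 1) :
    Module.IsTorsionBySet (IwasawaAlgebra p) (LocNilDual T f h)
      (Ideal.span {((1 + PowerSeries.X : IwasawaAlgebra p) ^ (p ^ n) - 1)}) :=
  (Module.isTorsionBySet_span_singleton_iff _).mpr fun x ↦ omega_smul_eq_zero_of_pow_eq_one h n hf x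

/-- **The two Fitting currencies agree modulo `(ω_n)`**: for the `Λ ⧸ (ω_n)`-module structure of a finitely generated
`LocNilDual T f h` with `f^{pⁿ} = 1`, `θ mod (ω_n) ∈ Fitt_k^{Λ/(ω_n)} ↔ θ ∈ Fitt_k^Λ + (ω_n)`
(`Module.mk_mem_fittingIdeal_quotientRing_iff`, Stacks 07ZA (3)). [cite: StacksProject, Tag 07ZA] -/
theorem mk_mem_fittingIdeal_iff_of_pow_eq_one (n : ℕ) (hf : f ^ p ^ n = 1)
    [Module.Finite (IwasawaAlgebra p) (LocNilDual T f h)] (k : ℕ) (θ : IwasawaAlgebra p) :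
    letI := (isTorsionBySet_of_pow_eq_one h n hf).module
    Ideal.Quotient.mk (Ideal.span {((1 + PowerSeries.X : IwasawaAlgebra p) ^ (p ^ n) - 1)}) θ ∈
        Module.fittingIdeal (IwasawaAlgebra p ⧸ Ideal.span {((1 + PowerSeries.X : IwasawaAlgebra p) ^ (p ^ n) - 1)})
          (LocNilDual T f h) k ↔
      θ ∈ Module.fittingIdeal (IwasawaAlgebra p) (LocNilDual T f h) k ⊔
        Ideal.span {((1 + PowerSeries.X : IwasawaAlgebra p) ^ (p ^ n) - 1)} := by
  letI := (isTorsionBySet_of_pow_eq_one h n hf).module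
  exact Module.mk_mem_fittingIdeal_quotientRing_iff _ k θ

end Generic

section Layer

variable {K : Type} [Field K] [NumberField K] {p : ℕ} [Fact p.Prime] (κ : ZpExtension K p)
  (W : WeierstrassCurve K) (𝔭 : HeightOneSpectrum (𝓞 K)) (S : Set (HeightOneSpectrum (𝓞 K)))
  (γ : absoluteGaloisGroup K) (n : ℕ)

/-- **`f^{pⁿ} = 1` on `Sel_𝔭^Σ(K_n, E[p^∞])`** for any endomorphism `f` agreeing with `conj_γ`: `f^{pⁿ}` agrees with
`conj_{γ^{pⁿ}}` (`coe_pow_apply_of_coe_eq`), the identity on `H¹(K_n, ·)` (`γ^{pⁿ} ∈ Gal(K̄/K_n)`, inner automorphisms).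
[cite: SerreLocalFields1979, VII.§5 Prop. 3] [cite: GreenbergLNM1716, §3 p. 85] -/
theorem pow_eq_one_of_coe_eq
    (f : AddMonoid.End ↥(selmerOver (κ.layerSubgroup n) (W.geomPrimaryTorsion p) p 𝔭 S))
    (hf : ∀ s, ((f s : selmerOver (κ.layerSubgroup n) (W.geomPrimaryTorsion p) p 𝔭 S) :
      W.subgroupH1 p (κ.layerSubgroup n)) = W.conjH1 p (κ.layerSubgroup n) γ s) :
    f ^ p ^ n = 1 := by
  have e2 : W.conjH1 p (κ.layerSubgroup n) (γ ^ p ^ n) = AddMonoidHom.id _ :=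
    conjH1_of_mem_holds (κ.layerSubgroup n) (W.geomPrimaryTorsion p)
      (CumulativeHeegnerInclusionAtThreeLayerControl.pow_prime_pow_mem_layerSubgroup κ γ n)
  apply DFunLike.ext
  intro s
  apply Subtype.ext
  rw [coe_pow_apply_of_coe_eq κ W 𝔭 S γ n f hf (p ^ n) s, AddMonoid.End.one_apply, e2, AddMonoidHom.id_apply]

/-- **`ω_n` kills the layer-`n` Selmer dual `Hom(Sel_𝔭^Σ(K_n, E[p^∞]), ℚ/ℤ)`** (`LocNilDual … f h`, any `f` agreeing with
`conj_γ`): it is a module over the layer ring `Λ ⧸ (ω_n) = ℤ_p[Gal(K_n/K)]`. [cite: Washington1997, §13.2] [cite: MazurTate1987, §1] -/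
theorem isTorsionBySet_layerDual
    (f : AddMonoid.End ↥(selmerOver (κ.layerSubgroup n) (W.geomPrimaryTorsion p) p 𝔭 S))
    (hf : ∀ s, ((f s : selmerOver (κ.layerSubgroup n) (W.geomPrimaryTorsion p) p 𝔭 S) :
      W.subgroupH1 p (κ.layerSubgroup n)) = W.conjH1 p (κ.layerSubgroup n) γ s)
    (h : IsLocNil p (f - 1)) :
    Module.IsTorsionBySet (IwasawaAlgebra p)
      (LocNilDual ↥(selmerOver (κ.layerSubgroup n) (W.geomPrimaryTorsion p) p 𝔭 S) f h)
      (Ideal.span {((1 + PowerSeries.X : IwasawaAlgebra p) ^ (p ^ n) - 1)}) :=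
  isTorsionBySet_of_pow_eq_one h n (pow_eq_one_of_coe_eq κ W 𝔭 S γ n f hf)

variable [hγ : Fact (κ.IsTopGenerator γ)]

/-- **Under exact control the layer dual is finitely generated over `Λ`** (it is `≅ₗ[Λ] X^Σ ⧸ ω_n X^Σ`,
`dualLayerMap_bijective_of_control`). [cite: GreenbergLNM1716, §1 p. 60] -/
theorem module_finite_layerDual_of_control [Module.Finite (IwasawaAlgebra p) (XAc W p κ 𝔭 S γ)]
    (f : AddMonoid.End ↥(selmerOver (κ.layerSubgroup n) (W.geomPrimaryTorsion p) p 𝔭 S))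
    (hf : ∀ s, ((f s : selmerOver (κ.layerSubgroup n) (W.geomPrimaryTorsion p) p 𝔭 S) :
      W.subgroupH1 p (κ.layerSubgroup n)) = W.conjH1 p (κ.layerSubgroup n) γ s)
    (h : IsLocNil p (f - 1))
    (hinj : Function.Injective (W.resOfLe p (κ.kerSubgroup_le_layerSubgroup n)))
    (hsurj : ∀ a ∈ selmerAc W p κ 𝔭 S, W.conjH1 p κ.kerSubgroup (γ ^ p ^ n) a = a →
      ∃ c ∈ selmerOver (κ.layerSubgroup n) (W.geomPrimaryTorsion p) p 𝔭 S,
        W.resOfLe p (κ.kerSubgroup_le_layerSubgroup n) c = a) :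
    Module.Finite (IwasawaAlgebra p)
      (LocNilDual ↥(selmerOver (κ.layerSubgroup n) (W.geomPrimaryTorsion p) p 𝔭 S) f h) := by
  let u : ↥(selmerOver (κ.layerSubgroup n) (W.geomPrimaryTorsion p) p 𝔭 S) →+ ↥(selmerAc W p κ 𝔭 S) :=
    { toFun := fun c ↦ ⟨W.resOfLe p (κ.kerSubgroup_le_layerSubgroup n) c,
        resOfLe_layer_mem_selmerOver κ n c.2⟩
      map_zero' := Subtype.ext (by simp)
      map_add' := fun a b ↦ Subtype.ext (by simp) }
  have hu : ∀ c, ((u c : selmerAc W p κ 𝔭 S) : W.subgroupH1 p κ.kerSubgroup) =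
      W.resOfLe p (κ.kerSubgroup_le_layerSubgroup n) c := fun _ ↦ rfl
  obtain ⟨q, hqbij, -⟩ := dualLayerMap_bijective_of_control κ W 𝔭 S γ n f hf h u hu hinj hsurj
  exact Module.Finite.equiv (LinearEquiv.ofBijective q hqbij)

/-- **The Mazur–Tate currency feeds the door**: under exact control at layer `n`, for any `θ ∈ Λ`,
`θ mod (ω_n) ∈ Fitt₀^{Λ/(ω_n)}(Hom(Sel_𝔭^Σ(K_n, E[p^∞]), ℚ/ℤ))` (the Fitting ideal over the LAYER RING of the layer Selmer
dual, i.e. the shape of a Kurihara / Kim–Kurihara statement) IFF `θ ∈ Fitt₀^Λ(Hom(Sel_𝔭^Σ(K_n), ℚ/ℤ)) + (ω_n)` (the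
hypothesis format of §2–§3). [cite: StacksProject, Tag 07ZA] [cite: KimKurihara2021, §1] -/
theorem mk_mem_fittingIdeal_layerDual_iff [Module.Finite (IwasawaAlgebra p) (XAc W p κ 𝔭 S γ)]
    (f : AddMonoid.End ↥(selmerOver (κ.layerSubgroup n) (W.geomPrimaryTorsion p) p 𝔭 S))
    (hf : ∀ s, ((f s : selmerOver (κ.layerSubgroup n) (W.geomPrimaryTorsion p) p 𝔭 S) :
      W.subgroupH1 p (κ.layerSubgroup n)) = W.conjH1 p (κ.layerSubgroup n) γ s)
    (h : IsLocNil p (f - 1))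
    (hinj : Function.Injective (W.resOfLe p (κ.kerSubgroup_le_layerSubgroup n)))
    (hsurj : ∀ a ∈ selmerAc W p κ 𝔭 S, W.conjH1 p κ.kerSubgroup (γ ^ p ^ n) a = a →
      ∃ c ∈ selmerOver (κ.layerSubgroup n) (W.geomPrimaryTorsion p) p 𝔭 S,
        W.resOfLe p (κ.kerSubgroup_le_layerSubgroup n) c = a)
    (θ : IwasawaAlgebra p) :
    letI := (isTorsionBySet_layerDual κ W 𝔭 S γ n f hf h).module
    Ideal.Quotient.mk (Ideal.span {((1 + PowerSeries.X : IwasawaAlgebra p) ^ (p ^ n) - 1)}) θ ∈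
        Module.fittingIdeal (IwasawaAlgebra p ⧸ Ideal.span {((1 + PowerSeries.X : IwasawaAlgebra p) ^ (p ^ n) - 1)})
          (LocNilDual ↥(selmerOver (κ.layerSubgroup n) (W.geomPrimaryTorsion p) p 𝔭 S) f h) 0 ↔
      θ ∈ Module.fittingIdeal (IwasawaAlgebra p)
          (LocNilDual ↥(selmerOver (κ.layerSubgroup n) (W.geomPrimaryTorsion p) p 𝔭 S) f h) 0 ⊔
        Ideal.span {((1 + PowerSeries.X : IwasawaAlgebra p) ^ (p ^ n) - 1)} := by
  haveI := module_finite_layerDual_of_control κ W 𝔭 S γ n f hf h hinj hsurj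
  exact mk_mem_fittingIdeal_iff_of_pow_eq_one h n (pow_eq_one_of_coe_eq κ W 𝔭 S γ n f hf) 0 θ

/-! ## §2 One layer: the (MT-Sel) clauses + control ⟹ the (LT) clause for `X^∅` -/

omit hγ in
/-- Transport of a membership `θ ∈ J + (ω)` along `φ` into a congruence: `φ ω ∈ 𝔟` and `t · L ∈ (φ θ) + 𝔟` give
`t · L ∈ J·S + 𝔟` (private algebra). [folklore] -/
private theorem mul_mem_map_sup_of_mem_sup_span {R : Type*} [CommRing R] {S' : Type*} [CommRing S']
    (φ : R →+* S') {J : Ideal R} {ω θ : R} {𝔟 : Ideal S'} (hω : φ ω ∈ 𝔟) (hθ : θ ∈ J ⊔ Ideal.span {ω})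
    {t L : S'} (hrec : t * L ∈ Ideal.span {φ θ} ⊔ 𝔟) : t * L ∈ J.map φ ⊔ 𝔟 := by
  have hφθ : φ θ ∈ J.map φ ⊔ 𝔟 := by
    obtain ⟨a, ha, b, hb, hab⟩ := Submodule.mem_sup.mp hθ
    obtain ⟨r, rfl⟩ := Ideal.mem_span_singleton'.mp hb
    rw [← hab, map_add, map_mul]
    exact Ideal.add_mem _ (Ideal.mem_sup_left (Ideal.mem_map_of_mem φ ha))
      (Ideal.mem_sup_right (Ideal.mul_mem_left _ _ hω))
  obtain ⟨y, hy, b, hb, hyb⟩ := Submodule.mem_sup.mp hrec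
  obtain ⟨r, rfl⟩ := Ideal.mem_span_singleton'.mp hy
  rw [← hyb]
  exact Ideal.add_mem _ (Ideal.mul_mem_left _ r hφθ) (Ideal.mem_sup_right hb)

/-- **One layer, generic**: for an elliptic curve `E/K`, a `ℤ_p`-extension `κ` with topological generator `γ`, `𝔭`,
`Σ` with `X_ac^Σ` finitely generated, a layer `n` at which control is EXACT (`res` injective on `H¹(K_n, E[p^∞])` and every
`conj_{γ^{pⁿ}}`-fixed class of `Sel_𝔭^Σ(K_∞)` lifts to `Sel_𝔭^Σ(K_n)`), and any presentation `(f, h)` of the layer dual: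
an element `θ ∈ Fitt₀^Λ(Hom(Sel_𝔭^Σ(K_n, E[p^∞]), ℚ/ℤ)) + (ω_n)` with `p^μ · L ∈ (φ θ) + (p^n) + (ω_n)` in `R₀⟦T⟧` gives
`p^μ · L ∈ Fitt₀^Λ(X_ac^∅)·R₀⟦T⟧ + (p^n) + (ω_n)` — the layer-`n` clause of (LT) for the `Σ = ∅` dual of crux A
(`fittingIdeal_layer_le_sup_of_control` + `fittingIdeal_XAc_le_empty`). [cite: MazurTate1987, §1] [cite: StacksProject, Tag 07ZA] -/
theorem pow_mul_mem_map_fittingIdeal_empty_sup_layer_of_selmerDual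
    [Module.Finite (IwasawaAlgebra p) (XAc W p κ 𝔭 S γ)]
    (f : AddMonoid.End ↥(selmerOver (κ.layerSubgroup n) (W.geomPrimaryTorsion p) p 𝔭 S))
    (hf : ∀ s, ((f s : selmerOver (κ.layerSubgroup n) (W.geomPrimaryTorsion p) p 𝔭 S) :
      W.subgroupH1 p (κ.layerSubgroup n)) = W.conjH1 p (κ.layerSubgroup n) γ s)
    (h : IsLocNil p (f - 1))
    (hinj : Function.Injective (W.resOfLe p (κ.kerSubgroup_le_layerSubgroup n)))
    (hsurj : ∀ a ∈ selmerAc W p κ 𝔭 S, W.conjH1 p κ.kerSubgroup (γ ^ p ^ n) a = a →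
      ∃ c ∈ selmerOver (κ.layerSubgroup n) (W.geomPrimaryTorsion p) p 𝔭 S,
        W.resOfLe p (κ.kerSubgroup_le_layerSubgroup n) c = a)
    {θ : IwasawaAlgebra p} (μ : ℕ) {L : UnrSeries p}
    (hθ : θ ∈ Module.fittingIdeal (IwasawaAlgebra p)
        (LocNilDual ↥(selmerOver (κ.layerSubgroup n) (W.geomPrimaryTorsion p) p 𝔭 S) f h) 0 ⊔
      Ideal.span {((1 + PowerSeries.X : IwasawaAlgebra p) ^ (p ^ n) - 1)})
    (hrec : ((p : ℕ) : UnrSeries p) ^ μ * L ∈ Ideal.span {PowerSeries.map (Halves.toUnr p) θ} ⊔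
      (Ideal.span {((p : ℕ) : UnrSeries p) ^ n} ⊔ Ideal.span {((1 + PowerSeries.X) ^ (p ^ n) - 1 : UnrSeries p)})) :
    ((p : ℕ) : UnrSeries p) ^ μ * L ∈
      (Module.fittingIdeal (IwasawaAlgebra p) (XAc W p κ 𝔭 ∅ γ) 0).map (PowerSeries.map (Halves.toUnr p)) ⊔
        (Ideal.span {((p : ℕ) : UnrSeries p) ^ n} ⊔ Ideal.span {((1 + PowerSeries.X) ^ (p ^ n) - 1 : UnrSeries p)}) := by
  -- `θ ∈ Fitt₀(X^Σ) + (ω_n) ⊆ Fitt₀(X^∅) + (ω_n)`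
  have h1 : θ ∈ Module.fittingIdeal (IwasawaAlgebra p) (XAc W p κ 𝔭 ∅ γ) 0 ⊔
      Ideal.span {((1 + PowerSeries.X : IwasawaAlgebra p) ^ (p ^ n) - 1)} := by
    have hle := sup_le_sup_right (fittingIdeal_layer_le_sup_of_control κ W 𝔭 S γ n f hf h hinj hsurj)
      (Ideal.span {((1 + PowerSeries.X : IwasawaAlgebra p) ^ (p ^ n) - 1)})
    rw [sup_assoc, sup_idem] at hle
    exact sup_le_sup_right (fittingIdeal_XAc_le_empty κ W 𝔭 S γ) _ (hle hθ)
  exact mul_mem_map_sup_of_mem_sup_span (PowerSeries.map (Halves.toUnr p))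
    (by rw [map_toUnr_omega]; exact Ideal.mem_sup_right (Ideal.mem_span_singleton_self _)) h1 hrec

end Layer

/-! ## §3 BY NAME: (MT-Sel) ⟹ A, P ∧ (MT-Sel) ⟹ K1, integral (MT-Sel) ⟹ K1 -/

section ByName

/-- From the layer-`m` (MT-Sel) clauses on the Leopoldt cell to the layer-`m` clause of (LT): exact control for
`Σ ⊇ {bad v ∤ 3}` is -w8's `cell_layerControl_of_bad_subset` (no residual input); then §2. Stated at one frame, for the
tower. [cite: GreenbergLNM1716, §3 Lemmas 3.1–3.3 and p. 90] [cite: MazurTate1987, §1] -/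
theorem forall_pow_mul_mem_of_selmerDual_on_cell (W : WeierstrassCurve ℚ) [W.IsElliptic] [W.IsGloballyMinimal]
    (N : ℕ) [NeZero N] (K : Type) [Field K] [NumberField K]
    (hO6 : Summit.BirchSwinnertonDyer.Rank1Residual.Additive.ClassO6 W 3)
    (hline : ∃ Φ : AddSubgroup (WeierstrassCurve.geomTorsion W ((3 : ℕ) : ℤ)),
      Literature.NumberTheory.EllipticCurves.Rank1Residual.IsRationalLine W 3 Φ ∧
      ∀ (v : IsDedekindDomain.HeightOneSpectrum (NumberField.RingOfIntegers ℚ)),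
        ((3 : ℕ) : NumberField.RingOfIntegers ℚ) ∈ v.asIdeal → ∀ 𝔓 ∈ v.primesAbove,
        ¬ (∀ g ∈ 𝔓.decompositionSubgroup (Field.absoluteGaloisGroup ℚ), ∀ P ∈ Φ, g • P = P) ∧
        ¬ (∀ g ∈ 𝔓.decompositionSubgroup (Field.absoluteGaloisGroup ℚ),
            ∀ P : WeierstrassCurve.geomTorsion W ((3 : ℕ) : ℤ), g • P - P ∈ Φ))
    (hN : W.conductorNorm ℤ = N) (hK : Literature.NumberTheory.EllipticCurves.IsImaginaryQuadratic K)
    (hHg : Literature.NumberTheory.EllipticCurves.SatisfiesHeegnerHypothesis N K)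
    (κ : Literature.NumberTheory.EllipticCurves.ZpExtension K 3) (γ : Field.absoluteGaloisGroup K)
    [hγ : Fact (κ.IsTopGenerator γ)]
    (𝔭' : IsDedekindDomain.HeightOneSpectrum (NumberField.RingOfIntegers K))
    (h𝔭' : ((3 : ℕ) : NumberField.RingOfIntegers K) ∈ 𝔭'.asIdeal)
    (Sg : Set (IsDedekindDomain.HeightOneSpectrum (NumberField.RingOfIntegers K))) (hSg : Sg.Finite)
    (hbad : ∀ v : HeightOneSpectrum (𝓞 K), ((3 : ℕ) : 𝓞 K) ∉ v.asIdeal →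
      ¬ (W.baseChange K).HasGoodReductionAt v → v ∈ Sg)
    (μ : ℕ) (θ : ℕ → IwasawaAlgebra 3) {L : UnrSeries 3}
    (hθ : ∀ m, ∃ (f : AddMonoid.End ↥(selmerOver (κ.layerSubgroup m) ((W.baseChange K).geomPrimaryTorsion 3) 3 𝔭' Sg))
      (_ : ∀ s, ((f s : ↥(selmerOver (κ.layerSubgroup m) ((W.baseChange K).geomPrimaryTorsion 3) 3 𝔭' Sg)) :
        (W.baseChange K).subgroupH1 3 (κ.layerSubgroup m)) = (W.baseChange K).conjH1 3 (κ.layerSubgroup m) γ s)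
      (h : IsLocNil 3 (f - 1)),
      θ m ∈ Module.fittingIdeal (IwasawaAlgebra 3)
          (LocNilDual ↥(selmerOver (κ.layerSubgroup m) ((W.baseChange K).geomPrimaryTorsion 3) 3 𝔭' Sg) f h) 0 ⊔
        Ideal.span {((1 + PowerSeries.X : IwasawaAlgebra 3) ^ (3 ^ m) - 1)})
    (hrec : ∀ m, ((3 : ℕ) : UnrSeries 3) ^ μ * L ∈ Ideal.span {PowerSeries.map (Halves.toUnr 3) (θ m)} ⊔
      Ideal.span {((3 : ℕ) : UnrSeries 3) ^ m} ⊔ Ideal.span {((1 + PowerSeries.X) ^ (3 ^ m) - 1 : UnrSeries 3)})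
    (m : ℕ) :
    ((3 : ℕ) : UnrSeries 3) ^ μ * L ∈
      (Module.fittingIdeal (IwasawaAlgebra 3) (XAc (W.baseChange K) 3 κ 𝔭' ∅ γ) 0).map
          (PowerSeries.map (Halves.toUnr 3)) ⊔
        Ideal.span {((3 : ℕ) : UnrSeries 3) ^ m} ⊔ Ideal.span {((1 + PowerSeries.X) ^ (3 ^ m) - 1 : UnrSeries 3)} := by
  haveI hEK : (W.baseChange K).IsElliptic := inferInstanceAs (W.map (algebraMap ℚ K)).IsElliptic
  haveI : Module.Finite (IwasawaAlgebra 3) (XAc (W.baseChange K) 3 κ 𝔭' Sg γ) := XAc.module_finite κ 𝔭' Sg γ hSg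
  obtain ⟨hinj, hlift⟩ := cell_layerControl_of_bad_subset W N K hO6 hline hN hK hHg κ γ hγ.out 𝔭' h𝔭' Sg m hbad
  obtain ⟨f, hf, h, hθm⟩ := hθ m
  have hsurj : ∀ a ∈ selmerAc (W.baseChange K) 3 κ 𝔭' Sg,
      (W.baseChange K).conjH1 3 κ.kerSubgroup (γ ^ 3 ^ m) a = a →
        ∃ c ∈ selmerOver (κ.layerSubgroup m) ((W.baseChange K).geomPrimaryTorsion 3) 3 𝔭' Sg,
          (W.baseChange K).resOfLe 3 (κ.kerSubgroup_le_layerSubgroup m) c = a := fun a ha hfix ↦ by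
    obtain ⟨c, ⟨hc, hcx⟩, -⟩ := hlift a ha hfix
    exact ⟨c, hc, hcx⟩
  have key := pow_mul_mem_map_fittingIdeal_empty_sup_layer_of_selmerDual κ (W.baseChange K) 𝔭' Sg γ m f hf h
    hinj hsurj μ hθm (by simpa only [sup_assoc] using hrec m)
  simpa only [sup_assoc] using key

/-- **The Mazur–Tate door on the genuine layer Selmer groups: (MT-Sel) ⟹ `TemperedHeegnerInclusionAtThree`.**
If at every frame of crux A there are a finite `Σ ⊇ {bad v ∤ 3}`, a fixed `3^μ` and layer elements `θ_m ∈ Λ = ℤ₃⟦T⟧` with,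
for EVERY layer `m`, (i) `θ_m ∈ Fitt₀^Λ(Hom(Sel_{𝔭′}^Σ(K_m, E[3^∞]), ℚ/ℤ)) + (ω_m)` — the Fitting ideal of the dual of the
FINITE-LAYER Selmer group (any presentation `(f, h)`, `f` agreeing with `conj_γ`; by `mk_mem_fittingIdeal_layerDual_iff` this
is the same as `θ̄_m ∈ Fitt₀^{Λ/(ω_m)}` over the layer ring `ℤ₃[Gal(K_m/K)]`, the Mazur–Tate / Kurihara currency) and
(ii) `3^μ · L ∈ (θ_m) + (3^m) + (ω_m)` in `R₀⟦T⟧` — then A holds, with the same `μ`. Exact control on the Leopoldt cell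
(-w8's `cell_layerControl_of_bad_subset`), its dual/Fitting form and the `Σ`-passage (`…LayerControlDual`), the (LT) door
(`temperedHeegnerInclusionAtThree_of_fittingLayerTower`). (MT-Sel) is displayed, not constructed.
[cite: MazurTate1987, §1] [cite: KimKurihara2021, §1] [cite: GreenbergLNM1716, §3 p. 90] [cite: StacksProject, Tag 07ZA] -/
theorem temperedHeegnerInclusionAtThree_of_mazurTateTower_selmerDual
    (hMT : ∀ (W : WeierstrassCurve ℚ) [W.IsElliptic] [W.IsGloballyMinimal] (N : ℕ) [NeZero N] (K : Type) [Field K] [NumberField K] (Dt : Literature.NumberTheory.EllipticCurves.ModularForms.ModularParametrizationData W N), Summit.BirchSwinnertonDyer.Rank1Residual.Additive.ClassO6 W 3 → Literature.NumberTheory.EllipticCurves.Rank1Residual.Red W 3 → (∃ Φ : AddSubgroup (WeierstrassCurve.geomTorsion W ((3 : ℕ) : ℤ)), Literature.NumberTheory.EllipticCurves.Rank1Residual.IsRationalLine W 3 Φ ∧ ∀ (v : IsDedekindDomain.HeightOneSpectrum (NumberField.RingOfIntegers ℚ)), ((3 : ℕ) : NumberField.RingOfIntegers ℚ) ∈ v.asIdeal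 → ∀ 𝔓 ∈ v.primesAbove, ¬ (∀ g ∈ 𝔓.decompositionSubgroup (Field.absoluteGaloisGroup ℚ), ∀ P ∈ Φ, g • P = P) ∧ ¬ (∀ g ∈ 𝔓.decompositionSubgroup (Field.absoluteGaloisGroup ℚ), ∀ P : WeierstrassCurve.geomTorsion W ((3 : ℕ) : ℤ), g • P - P ∈ Φ)) → W.analyticRank = 1 → W.conductorNorm ℤ = N → Literature.NumberTheory.EllipticCurves.IsImaginaryQuadratic K → Literature.NumberTheory.EllipticCurves.SatisfiesHeegnerHypothesis N K → ∀ (κ : Literature.NumberTheory.EllipticCurves.ZpExtension K 3), κ.IsAnticyclotomic → ∀ (γ : Field.absoluteGaloisGroup K) [Fact (κ.IsTopGenerator γ)] (𝔭 : IsDedekindDomain.HeightOneSpectrum (NumberField.RingOfIntegers K)), ((3 : ℕ) : NumberField.RingOfIntegers K) ∈ 𝔭.asIdeal → 𝔭.asIdeal.ramificationIdx (NumberField.RingOfIntegers ℚ) = 1 → 𝔭.asIdeal.inertiaDeg (NumberField.RingOfIntegers ℚ) = 1 → ∀ (𝔭' : IsDedekindDomain.HeightOneSpectrum (NumberField.RingOfIntegers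 K)), ((3 : ℕ) : NumberField.RingOfIntegers K) ∈ 𝔭'.asIdeal → 𝔭' ≠ 𝔭 → ∀ (ι' : PadicAlgCl 3 ≃+* ℂ), Summit.BirchSwinnertonDyer.BirchSwinnertonDyer.Theorems.SchneiderFree.BranchInducesPrime 3 ι' 𝔭 → ∀ (ΩK : ℂ) (Ωp : ℂ_[3]) (L : Literature.NumberTheory.EllipticCurves.UnrSeries 3), ΩK ≠ 0 → Ωp ≠ 0 → Literature.NumberTheory.EllipticCurves.IsBDPLFunction ι' 𝔭 κ γ Dt.f ΩK Ωp L → ∃ Sg : Set (IsDedekindDomain.HeightOneSpectrum (NumberField.RingOfIntegers K)), Sg.Finite ∧ (∀ v : IsDedekindDomain.HeightOneSpectrum (NumberField.RingOfIntegers K), ((3 : ℕ) : NumberField.RingOfIntegers K) ∉ v.asIdeal → ¬ (W.baseChange K).HasGoodReductionAt v → v ∈ Sg) ∧ ∃ μ : ℕ, ∃ θ : ℕ → Literature.NumberTheory.EllipticCurves.IwasawaAlgebra 3, ∀ m : ℕ, (∃ (f : AddMonoid.End ↥(Summit.BirchSwinnertonDyer.Rank1Residual.X11b.AcSelmer.selmerOver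 (κ.layerSubgroup m) ((W.baseChange K).geomPrimaryTorsion 3) 3 𝔭' Sg)) (_ : ∀ s, ((f s : ↥(Summit.BirchSwinnertonDyer.Rank1Residual.X11b.AcSelmer.selmerOver (κ.layerSubgroup m) ((W.baseChange K).geomPrimaryTorsion 3) 3 𝔭' Sg)) : (W.baseChange K).subgroupH1 3 (κ.layerSubgroup m)) = (W.baseChange K).conjH1 3 (κ.layerSubgroup m) γ s) (h : Literature.NumberTheory.EllipticCurves.IwasawaDual.IsLocNil 3 (f - 1)), θ m ∈ Literature.RingTheory.FittingIdeal.Module.fittingIdeal (Literature.NumberTheory.EllipticCurves.IwasawaAlgebra 3) (Summit.BirchSwinnertonDyer.BirchSwinnertonDyer.Theorems.BiquadraticEisensteinDescentDefs.LocNilDual ↥(Summit.BirchSwinnertonDyer.Rank1Residual.X11b.AcSelmer.selmerOver (κ.layerSubgroup m) ((W.baseChange K).geomPrimaryTorsion 3) 3 𝔭' Sg) f h) 0 ⊔ Ideal.span {((1 + PowerSeries.X) ^ (3 ^ m) - 1 : Literature.NumberTheory.EllipticCurves.IwasawaAlgebra 3)}) ∧ (3 : Literature.NumberTheory.EllipticCurves.UnrSeries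 3) ^ μ * L ∈ Ideal.span {PowerSeries.map (Summit.BirchSwinnertonDyer.Rank1Residual.X11b.Halves.toUnr 3) (θ m)} ⊔ Ideal.span {(3 : Literature.NumberTheory.EllipticCurves.UnrSeries 3) ^ m} ⊔ Ideal.span {((1 + PowerSeries.X) ^ (3 ^ m) - 1 : Literature.NumberTheory.EllipticCurves.UnrSeries 3)}) :
    Summit.BirchSwinnertonDyer.BirchSwinnertonDyer.Theses.CumulativeHeegnerLeopoldt.TemperedHeegnerInclusionAtThree := by
  refine temperedHeegnerInclusionAtThree_of_fittingLayerTower ?_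
  intro W _ _ N _ K _ _ Dt hO6 hRed hcell hr hN hK hHg κ hκ γ _ 𝔭 h𝔭 he hf 𝔭' h𝔭' hne ι' hι ΩK Ωp L hΩK hΩp hBDP
  obtain ⟨Sg, hSg, hbad, μ, θ, hθ⟩ :=
    hMT W N K Dt hO6 hRed hcell hr hN hK hHg κ hκ γ 𝔭 h𝔭 he hf 𝔭' h𝔭' hne ι' hι ΩK Ωp L hΩK hΩp hBDP
  refine ⟨μ, fun m ↦ ?_⟩
  rw [three_eq_natCast]
  exact forall_pow_mul_mem_of_selmerDual_on_cell W N K hO6 hcell hN hK hHg κ γ 𝔭' h𝔭' Sg hSg hbad μ θ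
    (fun m ↦ (hθ m).1) (fun m ↦ by rw [← three_eq_natCast]; exact (hθ m).2) m

/-- **K1 ⟸ P ∧ (MT-Sel)** by name (P = `ResidualSelmerPrintedInputAtThree`, CGLS22 Prop. 14, removing `3^μ` by saturation as in
`cumulativeHeegnerInclusionAtThree_of_print_of_fittingLayerTower`). [cite: CastellaGrossiLeeSkinner2022, §1.2 Prop. 14 (arXiv:2008.02571)]
[cite: MazurTate1987, §1] -/
theorem cumulativeHeegnerInclusionAtThree_of_print_of_mazurTateTower_selmerDual
    (hP : Summit.BirchSwinnertonDyer.BirchSwinnertonDyer.Theses.CumulativeHeegnerLeopoldt.ResidualSelmerPrintedInputAtThree)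
    (hMT : ∀ (W : WeierstrassCurve ℚ) [W.IsElliptic] [W.IsGloballyMinimal] (N : ℕ) [NeZero N] (K : Type) [Field K] [NumberField K] (Dt : Literature.NumberTheory.EllipticCurves.ModularForms.ModularParametrizationData W N), Summit.BirchSwinnertonDyer.Rank1Residual.Additive.ClassO6 W 3 → Literature.NumberTheory.EllipticCurves.Rank1Residual.Red W 3 → (∃ Φ : AddSubgroup (WeierstrassCurve.geomTorsion W ((3 : ℕ) : ℤ)), Literature.NumberTheory.EllipticCurves.Rank1Residual.IsRationalLine W 3 Φ ∧ ∀ (v : IsDedekindDomain.HeightOneSpectrum (NumberField.RingOfIntegers ℚ)), ((3 : ℕ) : NumberField.RingOfIntegers ℚ) ∈ v.asIdeal → ∀ 𝔓 ∈ v.primesAbove, ¬ (∀ g ∈ 𝔓.decompositionSubgroup (Field.absoluteGaloisGroup ℚ), ∀ P ∈ Φ, g • P = P) ∧ ¬ (∀ g ∈ 𝔓.decompositionSubgroup (Field.absoluteGaloisGroup ℚ), ∀ P : WeierstrassCurve.geomTorsion W ((3 : ℕ) : ℤ), g • P - P ∈ Φ)) → W.analyticRank = 1 → W.conductorNorm ℤ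 = N → Literature.NumberTheory.EllipticCurves.IsImaginaryQuadratic K → Literature.NumberTheory.EllipticCurves.SatisfiesHeegnerHypothesis N K → ∀ (κ : Literature.NumberTheory.EllipticCurves.ZpExtension K 3), κ.IsAnticyclotomic → ∀ (γ : Field.absoluteGaloisGroup K) [Fact (κ.IsTopGenerator γ)] (𝔭 : IsDedekindDomain.HeightOneSpectrum (NumberField.RingOfIntegers K)), ((3 : ℕ) : NumberField.RingOfIntegers K) ∈ 𝔭.asIdeal → 𝔭.asIdeal.ramificationIdx (NumberField.RingOfIntegers ℚ) = 1 → 𝔭.asIdeal.inertiaDeg (NumberField.RingOfIntegers ℚ) = 1 → ∀ (𝔭' : IsDedekindDomain.HeightOneSpectrum (NumberField.RingOfIntegers K)), ((3 : ℕ) : NumberField.RingOfIntegers K) ∈ 𝔭'.asIdeal → 𝔭' ≠ 𝔭 → ∀ (ι' : PadicAlgCl 3 ≃+* ℂ), Summit.BirchSwinnertonDyer.BirchSwinnertonDyer.Theorems.SchneiderFree.BranchInducesPrime 3 ι' 𝔭 → ∀ (ΩK : ℂ) (Ωp : ℂ_[3]) (L : Literature.NumberTheory.EllipticCurves.UnrSeries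 3), ΩK ≠ 0 → Ωp ≠ 0 → Literature.NumberTheory.EllipticCurves.IsBDPLFunction ι' 𝔭 κ γ Dt.f ΩK Ωp L → ∃ Sg : Set (IsDedekindDomain.HeightOneSpectrum (NumberField.RingOfIntegers K)), Sg.Finite ∧ (∀ v : IsDedekindDomain.HeightOneSpectrum (NumberField.RingOfIntegers K), ((3 : ℕ) : NumberField.RingOfIntegers K) ∉ v.asIdeal → ¬ (W.baseChange K).HasGoodReductionAt v → v ∈ Sg) ∧ ∃ μ : ℕ, ∃ θ : ℕ → Literature.NumberTheory.EllipticCurves.IwasawaAlgebra 3, ∀ m : ℕ, (∃ (f : AddMonoid.End ↥(Summit.BirchSwinnertonDyer.Rank1Residual.X11b.AcSelmer.selmerOver (κ.layerSubgroup m) ((W.baseChange K).geomPrimaryTorsion 3) 3 𝔭' Sg)) (_ : ∀ s, ((f s : ↥(Summit.BirchSwinnertonDyer.Rank1Residual.X11b.AcSelmer.selmerOver (κ.layerSubgroup m) ((W.baseChange K).geomPrimaryTorsion 3) 3 𝔭' Sg)) : (W.baseChange K).subgroupH1 3 (κ.layerSubgroup m)) = (W.baseChange K).conjH1 3 (κ.layerSubgroup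 m) γ s) (h : Literature.NumberTheory.EllipticCurves.IwasawaDual.IsLocNil 3 (f - 1)), θ m ∈ Literature.RingTheory.FittingIdeal.Module.fittingIdeal (Literature.NumberTheory.EllipticCurves.IwasawaAlgebra 3) (Summit.BirchSwinnertonDyer.BirchSwinnertonDyer.Theorems.BiquadraticEisensteinDescentDefs.LocNilDual ↥(Summit.BirchSwinnertonDyer.Rank1Residual.X11b.AcSelmer.selmerOver (κ.layerSubgroup m) ((W.baseChange K).geomPrimaryTorsion 3) 3 𝔭' Sg) f h) 0 ⊔ Ideal.span {((1 + PowerSeries.X) ^ (3 ^ m) - 1 : Literature.NumberTheory.EllipticCurves.IwasawaAlgebra 3)}) ∧ (3 : Literature.NumberTheory.EllipticCurves.UnrSeries 3) ^ μ * L ∈ Ideal.span {PowerSeries.map (Summit.BirchSwinnertonDyer.Rank1Residual.X11b.Halves.toUnr 3) (θ m)} ⊔ Ideal.span {(3 : Literature.NumberTheory.EllipticCurves.UnrSeries 3) ^ m} ⊔ Ideal.span {((1 + PowerSeries.X) ^ (3 ^ m) - 1 : Literature.NumberTheory.EllipticCurves.UnrSeries 3)}) :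
    Summit.BirchSwinnertonDyer.BirchSwinnertonDyer.Theses.CumulativeHeegnerLeopoldt.CumulativeHeegnerInclusionAtThree := by
  refine cumulativeHeegnerInclusionAtThree_of_print_of_fittingLayerTower hP ?_
  intro W _ _ N _ K _ _ Dt hO6 hRed hcell hr hN hK hHg κ hκ γ _ 𝔭 h𝔭 he hf 𝔭' h𝔭' hne ι' hι ΩK Ωp L hΩK hΩp hBDP
  obtain ⟨Sg, hSg, hbad, μ, θ, hθ⟩ :=
    hMT W N K Dt hO6 hRed hcell hr hN hK hHg κ hκ γ 𝔭 h𝔭 he hf 𝔭' h𝔭' hne ι' hι ΩK Ωp L hΩK hΩp hBDP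
  refine ⟨μ, fun m ↦ ?_⟩
  rw [three_eq_natCast]
  exact forall_pow_mul_mem_of_selmerDual_on_cell W N K hO6 hcell hN hK hHg κ γ 𝔭' h𝔭' Sg hSg hbad μ θ
    (fun m ↦ (hθ m).1) (fun m ↦ by rw [← three_eq_natCast]; exact (hθ m).2) m

/-- **K1 ⟸ the INTEGRAL (MT-Sel), print-free**: layer elements in `Fitt₀^Λ(Hom(Sel_{𝔭′}^Σ(K_m, E[3^∞]), ℚ/ℤ)) + (ω_m)`
dividing `L` itself modulo `(3^m, ω_m)` at every layer give `CumulativeHeegnerInclusionAtThree` outright (`Fitt ⊆ Ch` +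
`cumulativeHeegnerInclusionAtThree_of_integralCharLayerTower`). [cite: MazurTate1987, §1] [cite: SkinnerUrban2014, §3.1.6] -/
theorem cumulativeHeegnerInclusionAtThree_of_integralMazurTateTower_selmerDual
    (hMT : ∀ (W : WeierstrassCurve ℚ) [W.IsElliptic] [W.IsGloballyMinimal] (N : ℕ) [NeZero N] (K : Type) [Field K] [NumberField K] (Dt : Literature.NumberTheory.EllipticCurves.ModularForms.ModularParametrizationData W N), Summit.BirchSwinnertonDyer.Rank1Residual.Additive.ClassO6 W 3 → Literature.NumberTheory.EllipticCurves.Rank1Residual.Red W 3 → (∃ Φ : AddSubgroup (WeierstrassCurve.geomTorsion W ((3 : ℕ) : ℤ)), Literature.NumberTheory.EllipticCurves.Rank1Residual.IsRationalLine W 3 Φ ∧ ∀ (v : IsDedekindDomain.HeightOneSpectrum (NumberField.RingOfIntegers ℚ)), ((3 : ℕ) : NumberField.RingOfIntegers ℚ) ∈ v.asIdeal → ∀ 𝔓 ∈ v.primesAbove, ¬ (∀ g ∈ 𝔓.decompositionSubgroup (Field.absoluteGaloisGroup ℚ), ∀ P ∈ Φ, g • P = P) ∧ ¬ (∀ g ∈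 𝔓.decompositionSubgroup (Field.absoluteGaloisGroup ℚ), ∀ P : WeierstrassCurve.geomTorsion W ((3 : ℕ) : ℤ), g • P - P ∈ Φ)) → W.analyticRank = 1 → W.conductorNorm ℤ = N → Literature.NumberTheory.EllipticCurves.IsImaginaryQuadratic K → Literature.NumberTheory.EllipticCurves.SatisfiesHeegnerHypothesis N K → ∀ (κ : Literature.NumberTheory.EllipticCurves.ZpExtension K 3), κ.IsAnticyclotomic → ∀ (γ : Field.absoluteGaloisGroup K) [Fact (κ.IsTopGenerator γ)] (𝔭 : IsDedekindDomain.HeightOneSpectrum (NumberField.RingOfIntegers K)), ((3 : ℕ) : NumberField.RingOfIntegers K) ∈ 𝔭.asIdeal → 𝔭.asIdeal.ramificationIdx (NumberField.RingOfIntegers ℚ) = 1 → 𝔭.asIdeal.inertiaDeg (NumberField.RingOfIntegers ℚ) = 1 → ∀ (𝔭' : IsDedekindDomain.HeightOneSpectrum (NumberField.RingOfIntegers K)), ((3 : ℕ) : NumberField.RingOfIntegers K) ∈ 𝔭'.asIdeal → 𝔭' ≠ 𝔭 → ∀ (ι' : PadicAlgCl 3 ≃+* ℂ), Summit.BirchSwinnertonDyer.BirchSwinnertonDyer.Theorems.SchneiderFree.BranchInducesPrime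 3 ι' 𝔭 → ∀ (ΩK : ℂ) (Ωp : ℂ_[3]) (L : Literature.NumberTheory.EllipticCurves.UnrSeries 3), ΩK ≠ 0 → Ωp ≠ 0 → Literature.NumberTheory.EllipticCurves.IsBDPLFunction ι' 𝔭 κ γ Dt.f ΩK Ωp L → ∃ Sg : Set (IsDedekindDomain.HeightOneSpectrum (NumberField.RingOfIntegers K)), Sg.Finite ∧ (∀ v : IsDedekindDomain.HeightOneSpectrum (NumberField.RingOfIntegers K), ((3 : ℕ) : NumberField.RingOfIntegers K) ∉ v.asIdeal → ¬ (W.baseChange K).HasGoodReductionAt v → v ∈ Sg) ∧ ∃ θ : ℕ → Literature.NumberTheory.EllipticCurves.IwasawaAlgebra 3, ∀ m : ℕ, (∃ (f : AddMonoid.End ↥(Summit.BirchSwinnertonDyer.Rank1Residual.X11b.AcSelmer.selmerOver (κ.layerSubgroup m) ((W.baseChange K).geomPrimaryTorsion 3) 3 𝔭' Sg)) (_ : ∀ s, ((f s : ↥(Summit.BirchSwinnertonDyer.Rank1Residual.X11b.AcSelmer.selmerOver (κ.layerSubgroup m) ((W.baseChange K).geomPrimaryTorsion 3) 3 𝔭'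 Sg)) : (W.baseChange K).subgroupH1 3 (κ.layerSubgroup m)) = (W.baseChange K).conjH1 3 (κ.layerSubgroup m) γ s) (h : Literature.NumberTheory.EllipticCurves.IwasawaDual.IsLocNil 3 (f - 1)), θ m ∈ Literature.RingTheory.FittingIdeal.Module.fittingIdeal (Literature.NumberTheory.EllipticCurves.IwasawaAlgebra 3) (Summit.BirchSwinnertonDyer.BirchSwinnertonDyer.Theorems.BiquadraticEisensteinDescentDefs.LocNilDual ↥(Summit.BirchSwinnertonDyer.Rank1Residual.X11b.AcSelmer.selmerOver (κ.layerSubgroup m) ((W.baseChange K).geomPrimaryTorsion 3) 3 𝔭' Sg) f h) 0 ⊔ Ideal.span {((1 + PowerSeries.X) ^ (3 ^ m) - 1 : Literature.NumberTheory.EllipticCurves.IwasawaAlgebra 3)}) ∧ L ∈ Ideal.span {PowerSeries.map (Summit.BirchSwinnertonDyer.Rank1Residual.X11b.Halves.toUnr 3) (θ m)} ⊔ Ideal.span {(3 : Literature.NumberTheory.EllipticCurves.UnrSeries 3) ^ m} ⊔ Ideal.span {((1 + PowerSeries.X) ^ (3 ^ m) - 1 : Literature.NumberTheory.EllipticCurves.UnrSeries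 3)}) :
    Summit.BirchSwinnertonDyer.BirchSwinnertonDyer.Theses.CumulativeHeegnerLeopoldt.CumulativeHeegnerInclusionAtThree := by
  refine cumulativeHeegnerInclusionAtThree_of_integralCharLayerTower ?_
  intro W _ _ N _ K _ _ Dt hO6 hRed hcell hr hN hK hHg κ hκ γ _ 𝔭 h𝔭 he hf 𝔭' h𝔭' hne ι' hι ΩK Ωp L hΩK hΩp hBDP m
  haveI : (W.baseChange K).IsElliptic := inferInstanceAs (W.map (algebraMap ℚ K)).IsElliptic
  obtain ⟨Sg, hSg, hbad, θ, hθ⟩ :=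
    hMT W N K Dt hO6 hRed hcell hr hN hK hHg κ hκ γ 𝔭 h𝔭 he hf 𝔭' h𝔭' hne ι' hι ΩK Ωp L hΩK hΩp hBDP
  have hF := forall_pow_mul_mem_of_selmerDual_on_cell W N K hO6 hcell hN hK hHg κ γ 𝔭' h𝔭' Sg hSg hbad 0 θ (L := L)
    (fun m ↦ (hθ m).1) (fun m ↦ by rw [pow_zero, one_mul]; exact (hθ m).2) m
  rw [pow_zero, one_mul, ← three_eq_natCast] at hF
  exact sup_le_sup_right (sup_le_sup_right
    (map_fittingIdeal_le_map_charIdeal (W.baseChange K) 3 κ 𝔭' γ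
      (PowerSeries.map (Summit.BirchSwinnertonDyer.Rank1Residual.X11b.Halves.toUnr 3)))
    (Ideal.span {(3 : UnrSeries 3) ^ m})) (Ideal.span {((1 + PowerSeries.X) ^ (3 ^ m) - 1 : UnrSeries 3)}) hF

end ByName


section Presentation

variable {K : Type} [Field K] [NumberField K] {p : ℕ} [Fact p.Prime] (κ : ZpExtension K p)
  (W : WeierstrassCurve K) (𝔭 : HeightOneSpectrum (𝓞 K)) (S : Set (HeightOneSpectrum (𝓞 K)))
  (γ : absoluteGaloisGroup K) (n : ℕ)

/-- **§4 The canonical presentation `(f, h)` of the layer-`n` Selmer dual exists** (`f = conj_γ|_{Sel}`, tree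
`conjH1_mem_selmerOver`; `f − 1` locally nilpotent, `isLocNil_layer`): the `∃ f hf h` of (MT-Sel) is always instantiable.
[cite: GreenbergLNM1716, §1 p. 60 (after Conj. 1.3)] [cite: Castella2018, §2.1 (arXiv:1704.06608 p. 5)] -/
theorem exists_layerDual_presentation :
    ∃ (f : AddMonoid.End ↥(selmerOver (κ.layerSubgroup n) (W.geomPrimaryTorsion p) p 𝔭 S)),
      (∀ s, ((f s : selmerOver (κ.layerSubgroup n) (W.geomPrimaryTorsion p) p 𝔭 S) :
        W.subgroupH1 p (κ.layerSubgroup n)) = W.conjH1 p (κ.layerSubgroup n) γ s) ∧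
      IsLocNil p (f - 1) := by
  let f : AddMonoid.End ↥(selmerOver (κ.layerSubgroup n) (W.geomPrimaryTorsion p) p 𝔭 S) :=
    ((W.conjH1 p (κ.layerSubgroup n) γ).restrict
      (selmerOver (κ.layerSubgroup n) (W.geomPrimaryTorsion p) p 𝔭 S)).codRestrict
      (selmerOver (κ.layerSubgroup n) (W.geomPrimaryTorsion p) p 𝔭 S) fun s ↦ conjH1_mem_selmerOver γ s.2
  have hf : ∀ s, ((f s : selmerOver (κ.layerSubgroup n) (W.geomPrimaryTorsion p) p 𝔭 S) :
      W.subgroupH1 p (κ.layerSubgroup n)) = W.conjH1 p (κ.layerSubgroup n) γ s := fun _ ↦ rfl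
  exact ⟨f, hf, isLocNil_layer κ W 𝔭 S γ n f hf⟩

end Presentation

end Summit.BirchSwinnertonDyer.BirchSwinnertonDyer.Theorems.CumulativeHeegnerInclusionAtThreeLayerSelmerDualDoor

end
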